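import Mathlib
import HarnessLib
import Summits.Langlands.Langlands.Theses.SteinbergVelocityDst

/-!
# Birth skeleton (BC3) for crux stmt-Langlands-14049
`Summit.Langlands.Langlands.Theses.SteinbergVelocityDst.NonSplitSteinbergGraded` — line `birth`

Route `route-Langlands-SteinbergVelocityDst` (rank-3 crux).  The crux: in the setting of the route's
target X (K CM, π regular algebraic cuspidal on `GL_n(𝔸_K)`, `π_v` of Steinberg type, `ρ` semisimple and
C-Satake-compatible, an `E₀`-model `r_K`, the pinned `(φ, Γ)`-package `𝔇.IsSteinbergVelocityPackage 𝓐 𝓒`),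
if `D := (D_rig(r_K|Γ_{K_v})).conj U` is upper-triangular with the rank-one data `𝓡(δ_j)` on the diagonal,
cyclotomic, continuous, with SPECIAL consecutive ratios and SEMISTABLE, and the resulting special
triangulation `T = ofTriangular(D, 𝓡(δ_•), h)` is STRICT, then every graded pair is NON-SPLIT:
`T.IsNonSplitAt 𝔇.gen i hi`, i.e. the class `c_i ∈ H¹_{φ,γ_F}(𝓡(δ_iδ_{i+1}⁻¹))` of
`0 → 𝓡(δ_i) → Fil_{i+2}/Fil_i → 𝓡(δ_{i+1}) → 0` is non-zero (Ding's "non-critical special", hypothesis (d)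
of arXiv:2603.18961 Thm 2, to be PROVED for torsion-built `ρ`).

This skeleton is the route's own two-layer plan for the crux ("SlopeExclusion → CompanionExclusion → glue")
typed as a REFINEMENT-THEORETIC REDIRECT: a split graded pair is the same thing as a CRITICAL COMPANION
REFINEMENT of `D` — a second triangular basis whose diagonal data are the special data with the adjacent
pair `(δ_i, δ_{i+1})` TRANSPOSED — and the content of the crux is that the torsion-built `ρ_π` admits no
such companion refinement at a Steinberg place.

* `stub_companionBasis` — **LOCAL, pure `(φ, Γ)`-linear algebra over ANY `(φ, Γ)`-ring** (provable now, M):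
  if a framed module `D`, upper-triangular with rank-one data `d_•` on the diagonal, has a SPLIT graded pair
  `(i, i+1)` for `(φ, γ₀)` (`¬ IsNonSplitAt γ₀ i hi`, i.e. by `not_isNonSplitAt_iff_exists` a `z ∈ 𝓡` with
  `α_i φ(z) − α_{i+1} z = x_i`, `c_i(γ₀) γ₀(z) − c_{i+1}(γ₀) z = y_i(γ₀)`), then the change of basis
  `e'_i = e_{i+1} − z e_i`, `e'_{i+1} = e_i`, `e'_j = e_j (j ≠ i, i+1)` (a shear followed by the adjacent
  transposition, `U' ∈ GL_n(𝓡)`) makes the matrices of `φ` AND of `γ₀` upper-triangular again, with the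
  diagonal data `d ∘ (i i+1)` — the companion `(φ, γ₀)`-triangulation.  (Block check: with
  `P = [[α_i, x],[0, α_{i+1}]]`, `T = [[−z, 1],[1, 0]]`, `T⁻¹ P φ(T) = [[α_{i+1}, 0],[x + α_{i+1}z − α_iφ(z), α_i]]`,
  lower-left entry `= 0` by the coboundary equation; rows/columns outside `{i, i+1}` stay upper-triangular.)
* `stub_noCriticalCompanion` — **GLOBAL, the open content** ("companion exclusion at a Steinberg place"):
  in the full setting of the crux (all its hypotheses, strictness included), for every consecutive pair
  `(i, i+1)` there is NO basis `U'` of `D_rig(r_K|Γ_{K_v})` in which `φ` and `γ_F = 𝔇.gen` are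
  upper-triangular with diagonal data `𝓡(δ_{(i i+1)(j)})` — the special parameter with the pair transposed is
  not a `(φ, γ_F)`-parameter of `ρ_π` at `v`.  For the genuine data this follows from the EXPECTED maximal
  monodromy (`N^{n-1} ≠ 0` ⇒ `D_st(D)` has a unique complete `(φ, N)`-stable flag ⇒ `D` has a unique
  triangulation, Berger), and it is the statement that eigenvariety methods address directly: a transposed
  (anti-dominant at `(i, i+1)`) parameter of `ρ_π|Γ_{K_v}` is a critical COMPANION point of `x(π)` on the
  trianguline variety / eigenvariety (Bergdall2014, BreuilHellmannSchraen2017Smoothness, BreuilHellmannSchraen2019,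
  HansenUniversalEigenvarieties2017 Conj. 1.2.3), excluded for slope-protected pairs by Kedlaya slopes of the
  first step of the flag (`n = 2`, gap `≥ 2`) and in general only conjecturally (classicality at critical
  slope; `ℓ = p` local–global compatibility beyond AHTW2026's `N_Gal ≼ N_aut`).
* `NonSplitSteinbergGraded_of` — **the composition, kernel-checked:** fix the crux's context and a pair
  `(i, i+1)`; if the graded class vanished, `stub_companionBasis` (at `𝓡 = 𝔇.ring`, `γ₀ = 𝔇.gen`,
  `D = (D_rig(r_K|Γ_{K_v})).conj U`, `d = 𝓡(δ_•)`) gives `U'` and `conj_conj` turns it into the basis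
  `U U'` of `D_rig(r_K|Γ_{K_v})` forbidden by `stub_noCriticalCompanion`.  Concludes the route decl BY NAME.

Honest reading of the cut: `stub_companionBasis` is a theorem of linear algebra (no topology, no `p`-adic
Hodge theory: it is stated for `(φ, γ₀)` only, exactly the level at which the crux's `IsNonSplitAt 𝔇.gen` /
`IsStrict 𝔇.gen` live, so no density / Hausdorff argument is hidden in it); ALL the arithmetic difficulty
of the crux sits in the named global stub `stub_noCriticalCompanion`, which is implied by the target's
conclusion `N^{n-1} ≠ 0` on paper (uniqueness of the triangulation of a semistable `D` with maximal `N`)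
and implies the crux through the local stub; conversely the crux gives it back only through strictness +
`H⁰`-vanishing of the higher special ratios (KPX Prop. 6.2.8), so neither direction is a one-liner.
What the redirect buys: the statement to attack is no longer cohomological (`c_i ≠ 0`) but
refinement-theoretic (`(i i+1)·δ ∉ Par_{φ,γ_F}(ρ_π|Γ_{K_v})`), the form in which slope constraints on the
first step of a flag (Kedlaya; `HasKedlayaSlopes`, wanted) and companion-point / classicality theorems on
eigenvarieties apply.

Disproof used: none on file for this crux (`ledger crux ls stmt-Langlands-14049`: no `Disproof.lean`,
no `Negative/` lemmas, no dead lines, 2026-08-17).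

Shape (for `ledger skeleton check`): stubs `theorem stub_<name> : <signature> := by sorry` stated over tree
declarations only (`Literature.NumberTheory.GaloisRepresentations.{PhiGammaRing(.RankOneDatum),
FramedPhiGammaModule(.conj, .matPhi, .matGamma, .IsTriangularWith), PhiGammaModule.Triangulation(.ofTriangular,
.IsNonSplitAt, .ratioParam, .IsStrict), PhiGammaModuleRobbaLog(.IsSteinbergVelocityPackage, .IsSemistable),
PhiGammaModuleRobba(.gen, .ofChar, .IsCyclotomic, .H2, .DrigArtinian, .RelativeCharData), FramedGaloisRep(.toLocal,
.baseChange)}`, `Literature.NumberTheory.Automorphic.*` as in the crux, Mathlib `Matrix.BlockTriangular`,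
`Equiv.swap`); `_Goal.stub_<name> : Prop := type_of% @stub_<name>` names each statement; the composition
`NonSplitSteinbergGraded_of (hL : _Goal.stub_companionBasis) (hG : _Goal.stub_noCriticalCompanion) :
NonSplitSteinbergGraded` is proved without `sorry`.
-/

set_option linter.dupNamespace false
set_option linter.unusedVariables false

noncomputable section

namespace Summit.Langlands.Langlands.Cruxes.NonSplitSteinbergGraded.Birth

open Summit.Langlands.Langlands.Theses.SteinbergVelocityDst
open Literature.NumberTheory.GaloisRepresentations

/-! ## 1. The two stubs -/

/-- **STUB 1 — the companion basis of a split graded pair (local; pure `(φ, Γ)`-linear algebra).**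
Over ANY `(φ, Γ)`-ring `𝓡` (any group `Γ`, any `γ₀ ∈ Γ`): let the framed module `D` of rank `n` be
upper-triangular with the rank-one data `d_0, …, d_{n-1}` on the diagonal (`h`), and suppose the graded
pair `(i, i+1)` of the triangulation `ofTriangular D d h` is SPLIT for `(φ, γ₀)`, i.e. its class
`c_i ∈ H¹_{φ,γ₀}(𝓡(d_i d_{i+1}⁻¹))` vanishes (`¬ IsNonSplitAt γ₀ i hi`; by `not_isNonSplitAt_iff_exists`
there is `z ∈ 𝓡` with `α_i φ(z) − α_{i+1} z = x_i` and `c_i(γ₀) γ₀(z) − c_{i+1}(γ₀) z = y_i(γ₀)`, where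
`x_i = P_{i,i+1}`, `y_i(γ₀) = G(γ₀)_{i,i+1}` by `ofTriangular_phiCoeff` / `ofTriangular_actCoeff`).  Then in
the basis `e'_i = e_{i+1} − z e_i`, `e'_{i+1} = e_i`, `e'_j = e_j` otherwise (`U'` = shear × adjacent
transposition), the matrices `U'⁻¹ P φ(U')` of `φ` and `U'⁻¹ G(γ₀) γ₀(U')` of `γ₀` are again upper-triangular,
with diagonals `α_{d((i i+1) j)}` and `c_{d((i i+1) j)}(γ₀)`: the COMPANION `(φ, γ₀)`-triangulation with the
pair transposed.  (`2 × 2` block: `T = [[−z, 1],[1, 0]]`, `T⁻¹ = [[0, 1],[1, z]]`,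
`T⁻¹ [[α_i, x],[0, α_{i+1}]] φ(T) = [[α_{i+1}, 0],[x + α_{i+1} z − α_i φ(z), α_i]]`, lower-left `= 0` by the
first coboundary equation; likewise for `γ₀` with the second; entries outside the block stay above the
diagonal.)  Size: M (explicit `GL_n(𝓡)`-conjugation, `Matrix.BlockTriangular` bookkeeping).  Provable now;
nothing `p`-adic is used. [cite: KedlayaPottharstXiao2014, Def. 6.3.1] [cite: Ding2019SimpleL, §3.1]
[cite: BellaicheChenevier2009, §2.4 (critical refinements, arXiv:math/0602340 numbering)] -/
theorem stub_companionBasis :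
    ∀ (Γ : Type) [Group Γ] (E : Type) [CommRing E] (𝓡 : PhiGammaRing.{0, 0, 0} Γ E) (n : ℕ)
      (D : FramedPhiGammaModule 𝓡 n) (d : Fin n → 𝓡.RankOneDatum)
      (h : D.IsTriangularWith (fun j => ((d j).α : 𝓡.R)) (fun j γ => ((d j).c γ : 𝓡.R)))
      (γ₀ : Γ) (i : ℕ) (hi : i + 1 < n),
      ¬ (PhiGammaModule.Triangulation.ofTriangular D d h).IsNonSplitAt γ₀ i hi →
        ∃ U' : Matrix.GeneralLinearGroup (Fin n) 𝓡.R,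
          ((D.conj U').matPhi : Matrix (Fin n) (Fin n) 𝓡.R).BlockTriangular id ∧
          (∀ j : Fin n, ((D.conj U').matPhi : Matrix (Fin n) (Fin n) 𝓡.R) j j =
            ((d (Equiv.swap (⟨i, Nat.lt_of_succ_lt hi⟩ : Fin n) ⟨i + 1, hi⟩ j)).α : 𝓡.R)) ∧
          ((D.conj U').matGamma γ₀ : Matrix (Fin n) (Fin n) 𝓡.R).BlockTriangular id ∧
          ∀ j : Fin n, ((D.conj U').matGamma γ₀ : Matrix (Fin n) (Fin n) 𝓡.R) j j =
            ((d (Equiv.swap (⟨i, Nat.lt_of_succ_lt hi⟩ : Fin n) ⟨i + 1, hi⟩ j)).c γ₀ : 𝓡.R) := by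
  sorry

/-- **STUB 2 — no critical companion refinement at a Steinberg place (global; the open content).**
In the full setting of the crux (K CM; π regular algebraic cuspidal on `GL_n(𝔸_K)`, `n ≥ 2`; `ρ`
semisimple and C-Satake-compatible with `π`; `v ∣ p` in the sector with `π_v` of Steinberg type;
accessibility at every `w ∣ p`; a finite `E₀/ℚ_p` embedded in `ℚ̄_p` and an `E₀`-model `r_K` of `ρ`; a
`(φ, Γ_{K_v})`-datum `𝔇` with `D_rig` over Artinian coefficients `𝓐` and relative rank-one data `𝓒`
satisfying the pinned package; a basis `U` in which `D := D_rig(r_K|Γ_{K_v})` is upper-triangular with the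
data `𝓡(δ_j)`; cyclotomic, continuous, SPECIAL consecutive ratios, SEMISTABLE, and the special triangulation
STRICT), for every consecutive pair `(i, i+1)` there is NO basis `U'` of `D_rig(r_K|Γ_{K_v})` in which the
matrices of `φ` and of `γ_F = 𝔇.gen` are upper-triangular with diagonal data `𝓡(δ_{(i i+1)(j)})` — the
special parameter with the pair `(δ_i, δ_{i+1})` TRANSPOSED is not a `(φ, γ_F)`-parameter of `ρ_π` at `v`
(no critical companion refinement).  Why plausibly true: for the genuine data it follows from the expected
maximal monodromy at a Steinberg place (`N^{n-1} ≠ 0` on `D_st(D)` ⇒ the complete `(φ, N)`-stable flag of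
`D_st(D)` is unique ⇒ `D` has exactly one triangulation, whose order of parameters is the special one;
`δ_i ≠ δ_{i+1}` since the ratio is special) — it is the refinement-theoretic shadow of `ℓ = p` local–global
compatibility for the monodromy of torsion-built `ρ_π`, of which only `N_Gal ≼ N_aut` is known (AHTW2026).
Intended attack: a transposed parameter is an anti-dominant-at-`(i,i+1)` point of the trianguline variety
over `ρ_π|Γ_{K_v}`, i.e. a critical COMPANION point of the classical point `x(π)`; exclude it by Kedlaya
slopes of the first step of the putative flag where the pair is slope-protected (`n = 2` with gap `≥ 2`),
and by companion-point / classicality theorems on the eigenvariety otherwise (Bergdall2014 for the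
eigencurve; BreuilHellmannSchraen2017Smoothness, BreuilHellmannSchraen2019 local model; Hansen's
conjecture on `Par(ρ_x)`).  Why it might fail: for `n = 2` of weight-2 type and for interior pairs when
`n ≥ 3` nothing local protects the pair, and a genuinely crystalline `ρ_π|Γ_{K_v}` with Steinberg-type
Frobenius eigenvalues (`N_Gal = 0 ≺ N_aut`) would carry both refinements.  Size: XL (open).
[cite: BreuilHellmannSchraen2019, Thm. 1.1 and §4 (companion points)] [cite: BreuilHellmannSchraen2017Smoothness, Thm. 1.1]
[cite: Bergdall2014, Thm. 1.1] [cite: HansenUniversalEigenvarieties2017, Conj. 1.2.3 and Thm. 1.1.6]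
[cite: KedlayaPottharstXiao2014, Thm. 6.3.13] [cite: BellaicheChenevier2009, §2.4–2.5 (arXiv:math/0602340 numbering)]
[cite: AHTW2026, Thm. 1.2.1] [cite: Ding2019SimpleL, §3.1 and Lemma 3.2] [cite: BarreraGrahamWilliams2026, Thm. 2 (d)] -/
theorem stub_noCriticalCompanion :
    ∀ (K : Type) [Field K] [NumberField K] [NumberField.IsCMField K] (n : ℕ) (hcpt : Literature.NumberTheory.Automorphic.isCompact_glFiniteIntegralLevel n K) (π : Literature.NumberTheory.Automorphic.CuspidalAutomorphicRepData n K hcpt), 2 ≤ n → π.1.IsRegularAlgebraic → ∀ (p : ℕ) [Fact p.Prime] (ι : PadicAlgCl p ≃+* ℂ) (ρ : Literature.NumberTheory.GaloisRepresentations.FramedGaloisRep K (PadicAlgCl p) n), ρ.toGaloisRep.IsSemisimple → (∀ᶠ v : IsDedekindDomain.HeightOneSpectrum (NumberField.RingOfIntegers K) in Filter.cofinite, ∀ α : Multiset ℂ, π.1.HasSatakeParamAt v α → ρ.IsUnramifiedAt v ∧ ρ.HasFrobCharpolyAt v (Literature.NumberTheory.Automorphic.arithFrobPolyOfSatake ι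 v.residueCard n α)) → ∀ (v : IsDedekindDomain.HeightOneSpectrum (NumberField.RingOfIntegers K)) (hv : ((p : ℕ) : NumberField.RingOfIntegers K) ∈ v.asIdeal), (3 ≤ n ∨ 2 * (v.asIdeal.ramificationIdx ℤ * v.asIdeal.inertiaDeg ℤ) ≤ Module.finrank ℚ K) → (∀ (L : Literature.NumberTheory.Automorphic.LocalLanglandsDatum (v.adicCompletion K)) (πv : Literature.NumberTheory.Automorphic.SmoothIrrep (Matrix.GeneralLinearGroup (Fin n) (v.adicCompletion K))), π.1.HasLocalComponentAt v πv.ρ → ((L.recGL n (Literature.NumberTheory.Automorphic.IrrClass.mk πv)).out.1).N ^ (n - 1) ≠ 0) → (∀ w : Literature.NumberTheory.Automorphic.PlacesOver K p, ∃ (πw : Literature.NumberTheory.Automorphic.SmoothIrrep (Matrix.GeneralLinearGroup (Fin n) (w.1.adicCompletion K))) (χw : (Fin n → (w.1.adicCompletion K)ˣ) →* ℂˣ), π.1.HasLocalComponentAt w.1 πw.ρ ∧ Literature.NumberTheory.Automorphic.IsJacquetExponent πw χw) → ∀ (E₀ : Type) [Field E₀] [TopologicalSpace E₀] [IsTopologicalRing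 E₀] [Algebra ℚ_[p] E₀] [Module.Finite ℚ_[p] E₀] (emb : E₀ →+* PadicAlgCl p) (hemb : Topology.IsEmbedding emb), (∀ x : ℚ_[p], emb (algebraMap ℚ_[p] E₀ x) = algebraMap ℚ_[p] (PadicAlgCl p) x) → ∀ (rK : Literature.NumberTheory.GaloisRepresentations.FramedGaloisRep K E₀ n), (∃ P : Matrix.GeneralLinearGroup (Fin n) (PadicAlgCl p), Literature.NumberTheory.GaloisRepresentations.FramedRep.conj P (rK.baseChange emb hemb.continuous) = ρ) → ∀ (𝔇 : Literature.NumberTheory.GaloisRepresentations.PhiGammaModuleRobbaLog.{0, 0, 0} p (v.adicCompletion K) E₀) (𝓐 : 𝔇.DrigArtinian) (𝓒 : 𝔇.RelativeCharData), 𝔇.IsSteinbergVelocityPackage 𝓐 𝓒 (v.asIdeal.ramificationIdx ℤ * v.asIdeal.inertiaDeg ℤ) (v.asIdeal.inertiaDeg ℤ) → ∀ (U : Matrix.GeneralLinearGroup (Fin n) 𝔇.R) (δ : Fin n → ((v.adicCompletion K)ˣ →ₜ* E₀ˣ)) (h : ((𝔇.Drig (rK.toLocal v)).conj U).IsTriangularWith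 (fun j => ((𝔇.ofChar (δ j)).α : 𝔇.R)) (fun j σ => ((𝔇.ofChar (δ j)).c σ : 𝔇.R))), 𝔇.IsCyclotomic ((𝔇.Drig (rK.toLocal v)).conj U) → ((𝔇.Drig (rK.toLocal v)).conj U).toPhiGammaModule.IsContinuous → (∀ (i : ℕ) (hi : i + 1 < n), Module.finrank E₀ (𝔇.H2 ((Literature.NumberTheory.GaloisRepresentations.PhiGammaModule.Triangulation.ofTriangular ((𝔇.Drig (rK.toLocal v)).conj U) (fun j => 𝔇.ofChar (δ j)) h).ratioParam i hi).toModule) = 1) → 𝔇.IsSemistable ((𝔇.Drig (rK.toLocal v)).conj U).toPhiGammaModule (v.asIdeal.inertiaDeg ℤ) → (Literature.NumberTheory.GaloisRepresentations.PhiGammaModule.Triangulation.ofTriangular ((𝔇.Drig (rK.toLocal v)).conj U) (fun j => 𝔇.ofChar (δ j)) h).IsStrict 𝔇.gen → ∀ (i : ℕ) (hi : i + 1 < n), ¬ ∃ U' : Matrix.GeneralLinearGroup (Fin n) 𝔇.R, (((𝔇.Drig (rK.toLocal v)).conj U').matPhi : Matrix (Fin n) (Fin n) 𝔇.R).BlockTriangular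 id ∧ (∀ j : Fin n, (((𝔇.Drig (rK.toLocal v)).conj U').matPhi : Matrix (Fin n) (Fin n) 𝔇.R) j j = ((𝔇.ofChar (δ (Equiv.swap (⟨i, Nat.lt_of_succ_lt hi⟩ : Fin n) ⟨i + 1, hi⟩ j))).α : 𝔇.R)) ∧ (((𝔇.Drig (rK.toLocal v)).conj U').matGamma 𝔇.gen : Matrix (Fin n) (Fin n) 𝔇.R).BlockTriangular id ∧ ∀ j : Fin n, (((𝔇.Drig (rK.toLocal v)).conj U').matGamma 𝔇.gen : Matrix (Fin n) (Fin n) 𝔇.R) j j = ((𝔇.ofChar (δ (Equiv.swap (⟨i, Nat.lt_of_succ_lt hi⟩ : Fin n) ⟨i + 1, hi⟩ j))).c 𝔇.gen : 𝔇.R) := by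
  sorry

/-! ## 2. The stub statements as named `Prop`s (literally their types) -/

namespace _Goal

/-- The statement of `stub_companionBasis`, as a named `Prop` (literally its type). [folklore] -/
def stub_companionBasis : Prop :=
  type_of% @Summit.Langlands.Langlands.Cruxes.NonSplitSteinbergGraded.Birth.stub_companionBasis

/-- The statement of `stub_noCriticalCompanion`, as a named `Prop` (literally its type). [folklore] -/
def stub_noCriticalCompanion : Prop :=
  type_of% @Summit.Langlands.Langlands.Cruxes.NonSplitSteinbergGraded.Birth.stub_noCriticalCompanion

end _Goal

/-! ## 3. The composition (kernel-checked, no `sorry`): COMPANION BASIS → COMPANION EXCLUSION → the crux by name -/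

/-- **`NonSplitSteinbergGraded` from the two stubs.**  Fix the crux's context, a strict special
triangulation and a consecutive pair `(i, i+1)`.  If the graded class `c_i` vanished, `stub_companionBasis`
(at `𝓡 = 𝔇.ring`, `γ₀ = 𝔇.gen`, `D = (D_rig(r_K|Γ_{K_v})).conj U`, `d_j = 𝓡(δ_j)`) yields a basis `U'` of
`D` in which `φ` and `γ_F` are upper-triangular with the transposed data; by `conj_conj` this is the basis
`U U'` of `D_rig(r_K|Γ_{K_v})`, which `stub_noCriticalCompanion` forbids.  The hypotheses are, by name, the
statements of the two stubs; the conclusion is the route decl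
`Summit.Langlands.Langlands.Theses.SteinbergVelocityDst.NonSplitSteinbergGraded`. [folklore] -/
theorem NonSplitSteinbergGraded_of (hL : _Goal.stub_companionBasis) (hG : _Goal.stub_noCriticalCompanion) :
    Summit.Langlands.Langlands.Theses.SteinbergVelocityDst.NonSplitSteinbergGraded := by
  -- the stub statements, as the Π-types they literally are
  have hL' : type_of% @stub_companionBasis := hL
  have hG' : type_of% @stub_noCriticalCompanion := hG
  intro K _ _ _ n hcpt π hn hreg p _ ι ρ hss hcomp v hv hsect hSt hacc E₀ _ _ _ _ _ emb hemb hembQ rK hmodel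
    𝔇 𝓐 𝓒 hP U δ h hcyc hcont hspecial hsemis hstrict i hi
  -- suppose the graded pair `(i, i+1)` were split …
  by_contra hns
  -- … then the local stub produces the companion basis `U'` of `D = (D_rig(r_K|Γ_{K_v})).conj U` …
  obtain ⟨U', hU'⟩ :=
    hL' _ E₀ 𝔇.ring n ((𝔇.Drig (rK.toLocal v)).conj U) (fun j => 𝔇.ofChar (δ j)) h 𝔇.gen i hi hns
  -- … i.e. the basis `U U'` of `D_rig(r_K|Γ_{K_v})`, which the global stub forbids
  refine hG' K n hcpt π hn hreg p ι ρ hss hcomp v hv hsect hSt hacc E₀ emb hemb hembQ rK hmodel 𝔇 𝓐 𝓒 hP U δ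
    h hcyc hcont hspecial hsemis hstrict i hi ⟨U * U', ?_⟩
  rw [← FramedPhiGammaModule.conj_conj]
  exact hU'

/-- By-name sanity check (an `example`, not a declaration of the file): the two stubs feed the
composition as they stand. -/
example : Summit.Langlands.Langlands.Theses.SteinbergVelocityDst.NonSplitSteinbergGraded :=
  NonSplitSteinbergGraded_of stub_companionBasis stub_noCriticalCompanion

end Summit.Langlands.Langlands.Cruxes.NonSplitSteinbergGraded.Birth

end
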